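import Summits.HodgeConjecture.HodgeConjecture.Cruxes.BlochSeedDiscOne.ShellThreeDoorB

/-!
# CompanionRows — the (2)-type KERNEL ROWS behind the K4CORE-SAT companion table, at two hubs and generic in `h`, `s`
(plan-lens-HodgeAV-dual g18, 2026-08-31; commission director-hodge g30 R19.749: «the (2)ₛ companion table for partial-UNSAT readings» + the
RULE Nₛ question R19.742 (2)(c); memo of record `Cruxes/BlochSeedDiscOne/COMPANION-2S-RULE-N-g18.md`)

`line stmt-HodgeConjecture-18881 Cruxes/BlochSeedDiscOne/Lines/birth.lean 814a6a70c14e831a stub_rung_pad4_seedAt`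
KERNEL STATEMENTS ONLY — no `sorry`, no new axiom, no `instance`, no `notation`, no `decide`, no `native_decide`.
**Nothing here is proved toward HC ∕ HC_CM ∕ HC_AV ∕ №4 ∕ 26512 ∕ 18881 ∕ H2.**  Letters ≠ sheaves ≠ SEED.  Letter-model lemmas (coarse RULE D
`LeggedFloor.RuleD`, `Disj`, alphabet `D.OnAlphabet h`, ring `RingLe s`) under ONE displayed support-level binder of other seats, NOT proved
here: `NoHook s D` (no hub-free supported P cell carries a co-level-`s` letter; extremal g21 `FamilyLemmaLs.NoHook`; at `s = 4` it follows
from (M2₄) typed as «no hub-free P cell has an off-axis letter» for the F∕G classes and from BOXCAP Table A R19.742 (1) for the E class),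
plus `OffLow` for the tier-2 row.

§0 RESTATES VERBATIM (same bodies; credit plan-lens-HodgeAV-extremal g21 `FamilyLemmaLs.lean` leaf v2 for `RingLe`, `NoHook`, `OffLow`,
(L1)ₛ `noN_colS_oneHub`, (L2)ₛ `noP_off_colS_hub`, (L3)ₛ `noN_colPred_off_hub`, (L4)ₛ `noN_off_colS_HH`; dual g17 `FamilyLemmaN.lean`
for (2)ₛ `nHub_of_p_colS_hub`) ONLY because neither module is built on the farm snapshot at the time of writing (`lean check` rc 75
`unbuilt:…FamilyLemmaLs`, `unbuilt:…FamilyLemmaN`, 08:27Z–08:33Z); when they build, §0 is redundant and §1 can import them.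

## §1 — WHAT IS NEW (all with `h`, `s` free; one RULE-D block each)
* `pDeep_of_nRingPinned` — an N cell `y` with a co-level-`s` letter at `k` (ring-pinned) is supplied at the block `{i, k}` by a P cell
  that EQUALS `y` off `i` and is ONE NULL STEP DEEPER at `i` (no hub hypothesis at all).  Read on a thread N K·Z·H·H (`i` = the Z slot):
  the supplier is the two-hub ceiling-bearing P cell P K·Z′·H·H, Z′ strictly below Z; read on N K·H·H·H (`i` = a hub slot,
  `pAxisCharged_of_nRingPinned_hub`): the supplier is P K·Z′·H·H with Z′ a charged AXIS letter.  This is the «⇐» half of the sector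
  statement of the memo §3: every thread and every ceiling triple needs a two-hub P cell carrying the same ceiling letter.
* `nAxisLift_of_pTwoHubCeiling` — a P cell with a charged letter at `i`, a co-level-`s` letter at `k` and hubs at `j`, `g` forces
  (block `{i, j}`, edge step) the N cell «`x` with the `i` letter lifted one null step», and under `NoHook s` that lift is NOT off-axis
  ((L4)ₛ kills the off-axis lift): it is a hub or a charged axis letter — a ceiling triple N K·H·H·H or a THREAD N K·Z·H·H.  This is
  the «⇒» half.  `thread_of_pTwoHubCeiling_off`: if the `i` letter is off-axis the lift is charged (an off-axis letter cannot reach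
  the hub in one null step), i.e. a thread.  Instances at `s = 4` (memo §1∕§3): P GGHH ⇒ N AGHH; P FGHH ⇒ N AFHH (block {G,H}) and
  N CGHH ∨ N GHHu (block {F,H}); P EGHH ⇒ N AEHH; P BGHH ⇒ N GHHu; P DGHH ⇒ N AGHH ∨ N GHHu; … — hence UNSAT(N AGHH) ⇒ P GGHH = ∅,
  UNSAT(N AFHH) ⇒ P FGHH = ∅ in every `NoHook 4` world, with no cascade.
* `nHub_of_pColPredOffHub` — tier 2 of the table: a ONE-hub P cell with a charged letter at `i`, a co-level-`(s-1)` letter at `l`,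
  an off-axis letter at `k` (slots `i, l, k, j` distinct) and everything off the hub `j` charged forces «`x` with the `i` letter
  hubbed» (the charged lifts are (L3)ₛ cells): P CCDH ⇒ N CDHH, P ACDH ⇒ N CDHH, P BCCH ⇒ N BCHH at `s = 4` (`NoHook s`, `OffLow`, `3 ≤ s`).
Together with (2)ₛ these are every row of the companion table; the table's status («α-exact, β-conditional, not a raw K4X2
prediction») is the memo's §0, not a Lean statement.
-/

namespace Summit.HodgeConjecture.HodgeConjecture.Cruxes.BlochSeedDiscOne.CompanionRows

open Summit.HodgeConjecture.HodgeConjecture.Cruxes.BlochSeedDiscOne.DepthBoundA4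
open Summit.HodgeConjecture.HodgeConjecture.Cruxes.BlochSeedDiscOne.LeggedFloor
open Summit.HodgeConjecture.HodgeConjecture.Cruxes.BlochSeedDiscOne.ShellThreeDoorB

/-! ## §0 Vocabulary and the family lemmas used — VERBATIM restatements (credit: extremal g21 `FamilyLemmaLs`, dual g17 `FamilyLemmaN`) -/

/-- ring `s` of the register: every supported letter has co-level `≤ s` (body of `FamilyLemmaLs.RingLe`). -/
def RingLe (s : ℤ) (D : Design) : Prop := ∀ x ∈ D.suppN ++ D.suppP, ∀ f : Fin 4, (x f).colevel ≤ s

/-- **NoHookₛ** (extremal's binder, body of `FamilyLemmaLs.NoHook`): no hub-free supported P cell contains a letter of co-level `s`. -/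
def NoHook (s : ℤ) (D : Design) : Prop :=
  ∀ x ∈ D.suppP, (∀ f : Fin 4, (x f).colevel ≠ 0) → ∀ f : Fin 4, (x f).colevel ≠ s

/-- gs-eng-2 (B), second clause (body of `FamilyLemmaLs.OffLow`): in a HUB-FREE supported P cell an off-axis letter forces every
other letter to co-level `≤ 1`. -/
def OffLow (D : Design) : Prop :=
  ∀ x ∈ D.suppP, (∀ f : Fin 4, (x f).colevel ≠ 0) → ∀ k g : Fin 4, k ≠ g → OffAxis (x k) → (x g).colevel ≤ 1

theorem ringLe_three_iff (D : Design) : RingLe 3 D ↔ Ring3 D := Iff.rfl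

/-- **(L1)ₛ** (verbatim `FamilyLemmaLs.noN_colS_oneHub`). -/
theorem noN_colS_oneHub {h s : ℤ} {D : Design} (hD : D.OnAlphabet h) (hr : RuleD D) (hdis : Disj D) (hS : RingLe s D)
    (hB : NoHook s D) {y : Cell} (hy : y ∈ D.suppN) {k j : Fin 4} (hkj : k ≠ j) (hk : (y k).colevel = s)
    (hj : (y j).colevel = 0) (hch : ∀ f : Fin 4, f ≠ j → (y f).colevel ≠ 0) : False := by
  have hyA : ∀ f : Fin 4, (y f).OnAlphabet h := hD y (mem_supp_of_memN D hy)
  obtain ⟨x, hx, hs⟩ := ruleDN_any hr hy hkj (detects_of_col_ne_zero y k j (hch k hkj))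
  have hxA : ∀ f : Fin 4, (x f).OnAlphabet h := hD x (mem_supp_of_memP D hx)
  have hxk : x k = y k := by
    rcases hs.2.1 with he | hn
    · exact he
    · exfalso
      have h1 := col_lt_of_nullStep (hxA k) (hyA k) hn
      have h2 := hS x (mem_supp_of_memP D hx) k
      omega
  have hnj : NullStep (x j) (y j) := by
    rcases hs.2.2 with he | hn
    · exact (hdis x (by rw [cell_eq_of_supplies hs hxk he]; exact hy) hx).elim
    · exact hn
  have hxj : (x j).colevel ≠ 0 := by
    have h1 := col_lt_of_nullStep (hxA j) (hyA j) hnj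
    have h2 := col_nonneg (y j)
    omega
  have hxfree : ∀ f : Fin 4, (x f).colevel ≠ 0 := by
    intro f
    by_cases hfk : f = k
    · rw [hfk, hxk]; exact hch k hkj
    by_cases hfj : f = j
    · rw [hfj]; exact hxj
    · rw [hs.1 f hfk hfj]; exact hch f hfj
  exact hB x hx hxfree k (by rw [hxk, hk])

/-- **(L2)ₛ** (verbatim `FamilyLemmaLs.noP_off_colS_hub`). -/
theorem noP_off_colS_hub {h s : ℤ} {D : Design} (hD : D.OnAlphabet h) (hr : RuleD D) (hdis : Disj D) (hS : RingLe s D)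
    (hB : NoHook s D) {x : Cell} (hx : x ∈ D.suppP) {k l j : Fin 4} (hkj : k ≠ j) (hlj : l ≠ j) (hkl : k ≠ l)
    (hko : OffAxis (x k)) (hls : (x l).colevel = s) (hj0 : (x j).colevel = 0)
    (hch : ∀ f : Fin 4, f ≠ j → (x f).colevel ≠ 0) : False := by
  have hxA : ∀ f : Fin 4, (x f).OnAlphabet h := hD x (mem_supp_of_memP D hx)
  obtain ⟨y, hy, hs⟩ := ruleDP_any hr hx hkj
    (detects_of_col_ne_zero x k j (by have := two_le_colevel_of_offAxis _ hko; omega))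
  have hyA : ∀ f : Fin 4, (y f).OnAlphabet h := hD y (mem_supp_of_memN D hy)
  have hyj : x j = y j := by
    rcases hs.2.2 with he | hn
    · exact he
    · exact absurd hn (not_nullStep_of_col_zero (hxA j) (hyA j) hj0)
  have hnk : NullStep (x k) (y k) := by
    rcases hs.2.1 with he | hn
    · exact (hdis x (by rw [cell_eq_of_supplies hs he hyj]; exact hy) hx).elim
    · exact hn
  have hyk0 : (y k).colevel ≠ 0 := fun h0 => not_nullStep_hub_of_offAxis (hxA k) (hyA k) hko h0 hnk
  refine noN_colS_oneHub hD hr hdis hS hB hy hlj ?_ ?_ ?_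
  · rw [← hs.1 l hkl.symm hlj]; exact hls
  · rw [← hyj]; exact hj0
  · intro f hfj
    by_cases hfk : f = k
    · rw [hfk]; exact hyk0
    · rw [← hs.1 f hfk hfj]; exact hch f hfj

/-- **(L3)ₛ** (verbatim `FamilyLemmaLs.noN_colPred_off_hub`). -/
theorem noN_colPred_off_hub {h s : ℤ} {D : Design} (hD : D.OnAlphabet h) (hr : RuleD D) (hdis : Disj D)
    (hS : RingLe s D) (hB : NoHook s D) (hO : OffLow D) (hs3 : 3 ≤ s) {y : Cell} (hy : y ∈ D.suppN) {i k j : Fin 4}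
    (hij : i ≠ j) (hkj : k ≠ j) (hik : i ≠ k) (hi : (y i).colevel = s - 1) (hko : OffAxis (y k))
    (hj0 : (y j).colevel = 0) (hch : ∀ f : Fin 4, f ≠ j → (y f).colevel ≠ 0) : False := by
  have hyA : ∀ f : Fin 4, (y f).OnAlphabet h := hD y (mem_supp_of_memN D hy)
  obtain ⟨x, hx, hs⟩ := ruleDN_any hr hy hij (detects_of_col_ne_zero y i j (by rw [hi]; omega))
  have hxA : ∀ f : Fin 4, (x f).OnAlphabet h := hD x (mem_supp_of_memP D hx)
  have hxk : x k = y k := hs.1 k hik.symm hkj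
  have hxko : OffAxis (x k) := by rw [hxk]; exact hko
  rcases hs.2.2 with hej | hnj
  · have hni : NullStep (x i) (y i) := by
      rcases hs.2.1 with he | hn
      · exact (hdis x (by rw [cell_eq_of_supplies hs he hej]; exact hy) hx).elim
      · exact hn
    have hxi : (x i).colevel = s := by
      have h1 := col_lt_of_nullStep (hxA i) (hyA i) hni
      have h2 := hS x (mem_supp_of_memP D hx) i
      omega
    refine noP_off_colS_hub hD hr hdis hS hB hx hkj hij hik.symm hxko hxi (by rw [hej]; exact hj0) ?_
    intro f hfj
    by_cases hfi : f = i
    · rw [hfi, hxi]; omega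
    · rw [hs.1 f hfi hfj]; exact hch f hfj
  · have hxj0 : (x j).colevel ≠ 0 := by
      have h1 := col_lt_of_nullStep (hxA j) (hyA j) hnj
      have h2 := col_nonneg (y j)
      omega
    have hxi2 : s - 1 ≤ (x i).colevel := by
      have h1 := col_le_of_eq_or_null (hxA i) (hyA i) hs.2.1
      omega
    have hxfree : ∀ f : Fin 4, (x f).colevel ≠ 0 := by
      intro f
      by_cases hfi : f = i
      · rw [hfi]; omega
      by_cases hfj : f = j
      · rw [hfj]; exact hxj0
      · rw [hs.1 f hfi hfj]; exact hch f hfj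
    have h4 := hO x hx hxfree k i hik.symm hxko
    omega

/-- **(L4)ₛ** (verbatim `FamilyLemmaLs.noN_off_colS_HH`). -/
theorem noN_off_colS_HH {h s : ℤ} {D : Design} (hD : D.OnAlphabet h) (hr : RuleD D) (hdis : Disj D) (hS : RingLe s D)
    (hB : NoHook s D) {y : Cell} (hy : y ∈ D.suppN) {k l j g : Fin 4} (hkl : k ≠ l) (hkj : k ≠ j) (hkg : k ≠ g)
    (hlj : l ≠ j) (hlg : l ≠ g) (hjg : j ≠ g) (hko : OffAxis (y k))
    (hls : (y l).colevel = s) (hj0 : (y j).colevel = 0) (hg0 : (y g).colevel = 0) : False := by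
  have hyA : ∀ f : Fin 4, (y f).OnAlphabet h := hD y (mem_supp_of_memN D hy)
  have hs2 : 2 ≤ s := by
    have h1 := two_le_colevel_of_offAxis _ hko
    have h2 := hS y (mem_supp_of_memN D hy) k
    omega
  obtain ⟨x, hx, hs⟩ := ruleDN_any hr hy hlj (detects_of_col_ne_zero y l j (by rw [hls]; omega))
  have hxA : ∀ f : Fin 4, (x f).OnAlphabet h := hD x (mem_supp_of_memP D hx)
  have hxl : x l = y l := by
    rcases hs.2.1 with he | hn
    · exact he
    · exfalso
      have h1 := col_lt_of_nullStep (hxA l) (hyA l) hn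
      have h2 := hS x (mem_supp_of_memP D hx) l
      omega
  have hnj : NullStep (x j) (y j) := by
    rcases hs.2.2 with he | hn
    · exact (hdis x (by rw [cell_eq_of_supplies hs hxl he]; exact hy) hx).elim
    · exact hn
  have hxj0 : (x j).colevel ≠ 0 := by
    have h1 := col_lt_of_nullStep (hxA j) (hyA j) hnj
    have h2 := col_nonneg (y j)
    omega
  have hxk : x k = y k := hs.1 k hkl hkj
  have hxg : x g = y g := hs.1 g hlg.symm hjg.symm
  refine noP_off_colS_hub hD hr hdis hS hB hx hkg hlg hkl (by rw [hxk]; exact hko) (by rw [hxl]; exact hls)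
    (by rw [hxg]; exact hg0) ?_
  intro f hfg
  by_cases hfl : f = l
  · rw [hfl, hxl, hls]; omega
  by_cases hfj : f = j
  · rw [hfj]; exact hxj0
  by_cases hfk : f = k
  · rw [hfk, hxk]; have := two_le_colevel_of_offAxis _ hko; omega
  exact (fin4_exhaust k l j g f hkl hkj hkg hlj hlg hjg hfk hfl hfj hfg).elim

/-- **(2)ₛ** (verbatim `FamilyLemmaN.nHub_of_p_colS_hub`): a supported P cell with a charged letter at `i`, a co-level-`s` letter at
`k ≠ i`, a hub at `j` and every letter off `j` charged forces the supported N cell «`x` with the `i` letter replaced by a hub». -/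
theorem nHub_of_p_colS_hub {h s : ℤ} {D : Design} (hD : D.OnAlphabet h) (hr : RuleD D) (hdis : Disj D) (hS : RingLe s D)
    (hB : NoHook s D) {x : Cell} (hx : x ∈ D.suppP) {i k j : Fin 4} (hij : i ≠ j) (hik : i ≠ k) (hkj : k ≠ j)
    (hi : (x i).colevel ≠ 0) (hk : (x k).colevel = s) (hj : (x j).colevel = 0)
    (hch : ∀ f : Fin 4, f ≠ j → (x f).colevel ≠ 0) :
    ∃ y ∈ D.suppN, (∀ f : Fin 4, f ≠ i → y f = x f) ∧ (y i).colevel = 0 := by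
  obtain ⟨y, hy, hyf, hyn⟩ := edgeN_of_charged_hub hD hr hdis hx hij hi hj
  refine ⟨y, hy, hyf, ?_⟩
  by_contra hyi
  refine noN_colS_oneHub hD hr hdis hS hB hy hkj (by rw [hyf k hik.symm]; exact hk) (by rw [hyf j hij.symm]; exact hj) ?_
  intro f hfj
  by_cases hfi : f = i
  · rw [hfi]; exact hyi
  · rw [hyf f hfi]; exact hch f hfj

/-! ## §1 The new rows -/

/-- **`pDeep_of_nRingPinned`** («⇐» half of the sector statement; no hub hypothesis, no binder): a supported N cell `y` with a
co-level-`s` letter at `k` (`s ≠ 0`) is supplied at the block `{i, k}` (`i ≠ k`) by a supported P cell that equals `y` off `i`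
and is one null step DEEPER at `i` — the `k` letter cannot be deepened inside `RingLe s`, and `Disj` forbids equality.
Thread N K·Z·H·H (`i` = Z slot) ⇒ P K·Z′·H·H with Z′ strictly below Z (memo §3 (i): for Z = C these are P K·E·H·H, P K·F·H·H). -/
theorem pDeep_of_nRingPinned {h s : ℤ} {D : Design} (hD : D.OnAlphabet h) (hr : RuleD D) (hdis : Disj D) (hS : RingLe s D)
    (hs0 : s ≠ 0) {y : Cell} (hy : y ∈ D.suppN) {i k : Fin 4} (hik : i ≠ k) (hk : (y k).colevel = s) :
    ∃ x ∈ D.suppP, (∀ f : Fin 4, f ≠ i → x f = y f) ∧ NullStep (x i) (y i) := by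
  have hyA : ∀ f : Fin 4, (y f).OnAlphabet h := hD y (mem_supp_of_memN D hy)
  obtain ⟨x, hx, hsup⟩ := ruleDN_any hr hy hik.symm (detects_of_col_ne_zero y k i (by rw [hk]; exact hs0))
  have hxA : ∀ f : Fin 4, (x f).OnAlphabet h := hD x (mem_supp_of_memP D hx)
  have hxk : x k = y k := by
    rcases hsup.2.1 with he | hn
    · exact he
    · exfalso
      have h1 := col_lt_of_nullStep (hxA k) (hyA k) hn
      have h2 := hS x (mem_supp_of_memP D hx) k
      omega
  have hni : NullStep (x i) (y i) := by
    rcases hsup.2.2 with he | hn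
    · exact (hdis x (by rw [cell_eq_of_supplies hsup hxk he]; exact hy) hx).elim
    · exact hn
  refine ⟨x, hx, ?_, hni⟩
  intro f hfi
  by_cases hfk : f = k
  · rw [hfk]; exact hxk
  · exact hsup.1 f hfk hfi

/-- on the alphabet, a letter one null step below a hub is a charged AXIS letter. -/
theorem axisCharged_of_nullStep_hub {h : ℤ} {ℓ ℓ' : Letter} (hℓ : ℓ.OnAlphabet h) (hℓ' : ℓ'.OnAlphabet h)
    (hn : NullStep ℓ ℓ') (h0 : ℓ'.colevel = 0) : ℓ.colevel ≠ 0 ∧ ¬ OffAxis ℓ := by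
  refine ⟨?_, fun hoff => not_nullStep_hub_of_offAxis hℓ hℓ' hoff h0 hn⟩
  have h1 := col_lt_of_nullStep hℓ hℓ' hn
  have h2 := col_nonneg ℓ'
  omega

/-- **`pAxisCharged_of_nRingPinned_hub`**: the ceiling triple case — a supported N cell with a co-level-`s` letter at `k` and a hub at
`i ≠ k` (e.g. N K·H·H·H) is supplied at `{i, k}` by a P cell equal to it off `i` whose `i` letter is a CHARGED AXIS letter (a two-hub
P cell P K·Z′·H·H, Z′ ∈ {u, A, C, E, …}). -/
theorem pAxisCharged_of_nRingPinned_hub {h s : ℤ} {D : Design} (hD : D.OnAlphabet h) (hr : RuleD D) (hdis : Disj D)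
    (hS : RingLe s D) (hs0 : s ≠ 0) {y : Cell} (hy : y ∈ D.suppN) {i k : Fin 4} (hik : i ≠ k) (hk : (y k).colevel = s)
    (hi0 : (y i).colevel = 0) :
    ∃ x ∈ D.suppP, (∀ f : Fin 4, f ≠ i → x f = y f) ∧ (x i).colevel ≠ 0 ∧ ¬ OffAxis (x i) := by
  have hyA : ∀ f : Fin 4, (y f).OnAlphabet h := hD y (mem_supp_of_memN D hy)
  obtain ⟨x, hx, hxf, hni⟩ := pDeep_of_nRingPinned hD hr hdis hS hs0 hy hik hk
  have hxA : ∀ f : Fin 4, (x f).OnAlphabet h := hD x (mem_supp_of_memP D hx)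
  exact ⟨x, hx, hxf, axisCharged_of_nullStep_hub (hxA i) (hyA i) hni hi0⟩

/-- **`nAxisLift_of_pTwoHubCeiling`** («⇒» half of the sector statement): a supported P cell with a charged letter at `i`, a
co-level-`s` letter at `k`, and hubs at `j` and `g` (four distinct slots) forces — edge step at the block `{i, j}` — the supported
N cell «`x` with the `i` letter lifted one null step», and under `NoHook s` the lifted letter is NOT off-axis (an off-axis lift
would be an (L4)ₛ cell): it is the hub (a ceiling triple N K·H·H·H) or a charged axis letter (a THREAD N K·Z·H·H).
`s = 4`: P FGHH ⇒ (i = G slot) N F·A·H·H; P GGHH ⇒ N A·G·H·H; P EGHH ⇒ (i = G) N A·E·H·H; P CGHH ⇒ (i = C) N AGHH ∨ GHHu ∨ GHHH. -/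
theorem nAxisLift_of_pTwoHubCeiling {h s : ℤ} {D : Design} (hD : D.OnAlphabet h) (hr : RuleD D) (hdis : Disj D)
    (hS : RingLe s D) (hB : NoHook s D) {x : Cell} (hx : x ∈ D.suppP) {i k j g : Fin 4} (hik : i ≠ k) (hij : i ≠ j)
    (hig : i ≠ g) (hkj : k ≠ j) (hkg : k ≠ g) (hjg : j ≠ g) (hi : (x i).colevel ≠ 0) (hk : (x k).colevel = s)
    (hj : (x j).colevel = 0) (hg : (x g).colevel = 0) :
    ∃ y ∈ D.suppN, (∀ f : Fin 4, f ≠ i → y f = x f) ∧ NullStep (x i) (y i) ∧ ¬ OffAxis (y i) := by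
  obtain ⟨y, hy, hyf, hyn⟩ := edgeN_of_charged_hub hD hr hdis hx hij hi hj
  refine ⟨y, hy, hyf, hyn, ?_⟩
  intro hoff
  exact noN_off_colS_HH hD hr hdis hS hB hy hik hij hig hkj hkg hjg hoff (by rw [hyf k hik.symm]; exact hk)
    (by rw [hyf j hij.symm]; exact hj) (by rw [hyf g hig.symm]; exact hg)

/-- **`thread_of_pTwoHubCeiling_off`**: if moreover the `i` letter is OFF-AXIS, the forced lift is CHARGED (an off-axis letter cannot
reach the hub in one null step), i.e. the forced N cell is a thread N K·Z·H·H with Z a charged axis letter strictly above the `i`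
letter.  `s = 4`: P GGHH ⇒ N AGHH; P FGHH ⇒ N AFHH; P BGHH ⇒ N GHHu; P BFHH ⇒ N FHHu; P DGHH ⇒ N AGHH ∨ N GHHu — so in every `NoHook 4`
world UNSAT(N AGHH) empties P GGHH and UNSAT(N AFHH) empties P FGHH with no cascade (memo §1, §3 (i)). -/
theorem thread_of_pTwoHubCeiling_off {h s : ℤ} {D : Design} (hD : D.OnAlphabet h) (hr : RuleD D) (hdis : Disj D)
    (hS : RingLe s D) (hB : NoHook s D) {x : Cell} (hx : x ∈ D.suppP) {i k j g : Fin 4} (hik : i ≠ k) (hij : i ≠ j)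
    (hig : i ≠ g) (hkj : k ≠ j) (hkg : k ≠ g) (hjg : j ≠ g) (hio : OffAxis (x i)) (hk : (x k).colevel = s)
    (hj : (x j).colevel = 0) (hg : (x g).colevel = 0) :
    ∃ y ∈ D.suppN, (∀ f : Fin 4, f ≠ i → y f = x f) ∧ NullStep (x i) (y i) ∧ ¬ OffAxis (y i) ∧ (y i).colevel ≠ 0 := by
  have hxA : ∀ f : Fin 4, (x f).OnAlphabet h := hD x (mem_supp_of_memP D hx)
  have hi : (x i).colevel ≠ 0 := by have := two_le_colevel_of_offAxis _ hio; omega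
  obtain ⟨y, hy, hyf, hyn, hya⟩ := nAxisLift_of_pTwoHubCeiling hD hr hdis hS hB hx hik hij hig hkj hkg hjg hi hk hj hg
  have hyA : ∀ f : Fin 4, (y f).OnAlphabet h := hD y (mem_supp_of_memN D hy)
  exact ⟨y, hy, hyf, hyn, hya, fun h0 => not_nullStep_hub_of_offAxis (hxA i) (hyA i) hio h0 hyn⟩

/-- the lifted letter of `nAxisLift_of_pTwoHubCeiling` has co-level strictly below the `i` letter's and strictly below `s`
(it is a LOWER letter: the thread's Z has co-level `< s`). -/
theorem colevel_lift_lt {h s : ℤ} {D : Design} (hD : D.OnAlphabet h) (hS : RingLe s D) {x y : Cell} (hx : x ∈ D.suppP)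
    (hy : y ∈ D.suppN) {i : Fin 4} (hn : NullStep (x i) (y i)) : (y i).colevel < (x i).colevel ∧ (y i).colevel < s := by
  have hxA : ∀ f : Fin 4, (x f).OnAlphabet h := hD x (mem_supp_of_memP D hx)
  have hyA : ∀ f : Fin 4, (y f).OnAlphabet h := hD y (mem_supp_of_memN D hy)
  have h1 := col_lt_of_nullStep (hxA i) (hyA i) hn
  have h2 := hS x (mem_supp_of_memP D hx) i
  exact ⟨h1, by omega⟩

/-- **`nHub_of_pColPredOffHub`** (tier 2 of the table, `3 ≤ s`): a supported ONE-hub P cell with a charged letter at `i`, a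
co-level-`(s-1)` letter at `l`, an off-axis letter at `k`, the hub at `j` (four distinct slots; so every letter off `j` is one of
these three and charged) forces the supported N cell «`x` with the `i` letter replaced by a hub»: a charged lift at `i` is an (L3)ₛ
cell (co-level-`(s-1)` letter at `l`, off-axis at `k`, hub `j`, rest charged).  `s = 4`: P CCDH ⇒ N CDHH (i = one C slot, l = the
other), P ACDH ⇒ N CDHH (i = A), P BCCH ⇒ N BCHH (i = one C, k = B) — so UNSAT(N CDHH) empties P CCDH and P ACDH in every
`NoHook 4 ∧ OffLow` world (memo §1 tier 2). -/
theorem nHub_of_pColPredOffHub {h s : ℤ} {D : Design} (hD : D.OnAlphabet h) (hr : RuleD D) (hdis : Disj D)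
    (hS : RingLe s D) (hB : NoHook s D) (hO : OffLow D) (hs3 : 3 ≤ s) {x : Cell} (hx : x ∈ D.suppP) {i l k j : Fin 4}
    (hil : i ≠ l) (hik : i ≠ k) (hij : i ≠ j) (hlk : l ≠ k) (hlj : l ≠ j) (hkj : k ≠ j)
    (hi : (x i).colevel ≠ 0) (hl : (x l).colevel = s - 1) (hko : OffAxis (x k)) (hj : (x j).colevel = 0) :
    ∃ y ∈ D.suppN, (∀ f : Fin 4, f ≠ i → y f = x f) ∧ (y i).colevel = 0 := by
  obtain ⟨y, hy, hyf, hyn⟩ := edgeN_of_charged_hub hD hr hdis hx hij hi hj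
  refine ⟨y, hy, hyf, ?_⟩
  by_contra hyi
  refine noN_colPred_off_hub hD hr hdis hS hB hO hs3 hy hlj hkj hlk (by rw [hyf l hil.symm]; exact hl)
    (by rw [hyf k hik.symm]; exact hko) (by rw [hyf j hij.symm]; exact hj) ?_
  intro f hfj
  by_cases hfi : f = i
  · rw [hfi]; exact hyi
  by_cases hfl : f = l
  · rw [hfl, hyf l hil.symm, hl]; omega
  by_cases hfk : f = k
  · rw [hfk, hyf k hik.symm]; have := two_le_colevel_of_offAxis _ hko; omega
  exact (fin4_exhaust i l k j f hil hik hij hlk hlj hkj hfi hfl hfk hfj).elim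

/-! ## Coverage ∕ honesty
`#print axioms` of every theorem here: `propext`, `Classical.choice`, `Quot.sound` only (no `sorry`).  The rows are implications
between SUPPORTED CELLS of one design; «UNSAT(thread) in K4X2 ⇒ client empty» uses them inside a world that satisfies `NoHook 4`
(reading α) — the K4X2 CNF itself carries no binder units (README-K4X2 §2 F6), so nothing here predicts a raw SAT verdict.
RULE N₄ itself (all threads empty) is NOT proved here and is not a consequence of these rows: the memo's §3 exhibits the
self-sustaining two-hub ceiling sector under coarse Rule D + every displayed binder. -/
theorem scope_note : True := trivial

end Summit.HodgeConjecture.HodgeConjecture.Cruxes.BlochSeedDiscOne.CompanionRows
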